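import Mathlib
import HarnessLib
import Summits.HubbardSuperconductivity.HubbardSuperconductivity.Theorems.KLProgrammeFreeBandJetAlgebra
import Summits.HubbardSuperconductivity.HubbardSuperconductivity.Theorems.KLProgrammeFreeBandJetSymmetry
import Summits.HubbardSuperconductivity.HubbardSuperconductivity.Theorems.KLProgrammeFreeBandJetCheckSoundBox
import Summits.HubbardSuperconductivity.HubbardSuperconductivity.Theorems.KLProgrammeFreeBandJetCertA
import Summits.HubbardSuperconductivity.HubbardSuperconductivity.Theorems.KLProgrammePerturbedFermiCurveWindowJetsOrderZero

/-!
# Route `KLProgramme` — ENGINE crux `KLRegimeEngineV17F2` (stmt-HubbardSuperconductivity-20437), row (C) `stub_twoLeg_curvature`: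
# **`klwjCertA_holds : KlwjCertA`** — THE POLAR-JET TABLE `klwjTableA` OF THE FREE BAND IS A THEOREM (KLWJ-INKERNEL part 4, assembly)
# (cell gate-hubbard-kl, seat hubbard-kl-k3c5-p1 g21; docket «KLWJ-INKERNEL-ROUTE» (p1b g19 memo 5340b98f1348eb46); 0 kit)

The (C) closer of record `EngineV8.A24a1G14.stub_twoLeg_curvature_of_producers_guard hexZ hcertA hres′` carries the producer
hypothesis `hcertA : KlwjCertA := FreeBandPolarJets (-1.0875) (-0.1125) klwjTableA` (`…PerturbedFermiCurveWindowJetsDefs`): sixteen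
numbers bounding the free band's polar Fermi radius `u_μ`, its radial slope `∂_tF(θ, u_μ θ)`, its polar Jacobian `u_μ/∂_tF` and their
first four angular derivatives on `μ ∈ [-1.0875, -0.1125]`, all angles — until now certified OUTSIDE Lean (kit j284931 / j284476) and
carried as a named hypothesis.  THIS FILE DISCHARGES IT:
* the four order-zero entries are p1b's `klwjA_orderZero` (`…WindowJetsOrderZero`), and `klwjCertA_of_jets` reduces `KlwjCertA` to the
  twelve derivative entries;
* the twelve derivative entries: part 1b (`iteratedDeriv k (bandFermiRadius μ) θ = ⟦Dc^[k] (atom 2)⟧(θ, u_μ θ)`, radial slope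
  `⟦Dc^[k] E01⟧`, polar Jacobian `⟦Dc^[k] (atom 2 / W)⟧`), part 3a (the free run of the program `jetProg` holds exactly these terms),
  part 2b (`checkCert_sound`: a passing certificate bounds `|⟦treeAlg.out jetProg r⟧(θ, t)|` by the table at every point of the root
  box whose level `F(θ, t)` lies in the window) and part 3c (`certA_ok`: the kernel accepted the 825-leaf certificate `certA` on
  `[0, 3927/5000] × [1829/1000, 2807/1000]` for the window `[-87/80, -9/80]`) give the rows at every `θ ∈ [0, π/4]` (the point
  `(θ, u_μ θ)` lies in the root box by the order-zero entries and `π/4 < 0.7854`, its level is `μ`); part 1c (`exists_octant_absJets`: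
  the absolute jets are even and `π/2`-periodic) moves every angle into the first octant.
Main results: `jetRows_octant`, `klwjA_jets_octant`, `klwjA_jets`, **`klwjCertA_holds : KlwjCertA`** (axioms: the three standard ones;
the interval arithmetic is the tree's `NumericsMP.MI`, every operation with an inclusion theorem; ZERO kit).  A consumer replaces the
binder `hcertA` by `klwjCertA_holds`.
Honest framing: a statement about the FREE dispersion `ε₀(k) = -2(cos k₁ + cos k₂)` only; nothing here asserts row (C), any stub of
20437, K3, U₀, the window, a margin or superconductivity in the Hubbard model.
References: BGM 2006 §2.4 Lemma 2.1 (2.40) [cite: BenfattoGiulianiMastropietro2006]; R. E. Moore, *Interval Analysis* (1966) [folklore].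
-/

noncomputable section

namespace Summit.HubbardSuperconductivity.HubbardSuperconductivity.Theorems.FreeBandJets

set_option linter.dupNamespace false -- summit = problem name (single-conjunct summit), D-0017

open Real Set Literature.MathematicalPhysics.QuantumLattice Literature.Analysis.ValidatedNumerics.NumericsMP
open Summit.HubbardSuperconductivity.HubbardSuperconductivity.Theorems.PerturbedFermiCurve

/-! ## §1 The thirteen rows at a point of the first octant -/

/-- **The rows of the program on the window, first octant**: for `μ ∈ [-1.0875, -0.1125]` and `θ ∈ [0, π/4]`, the thirteen
derivative rows of `tabA` hold for the terms of `jetProg` at `(θ, u_μ θ)` — the certificate `certA` read through `checkCert_sound`. -/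
theorem jetRows_octant {μ : ℝ} (hμ : μ ∈ Icc (-1.0875 : ℝ) (-0.1125)) {θ : ℝ} (hθ : θ ∈ Icc 0 (π / 4)) :
    JetRows jetProg jetIx tabA θ (bandFermiRadius μ θ) := by
  have hμ₁ : -4 < μ := by linarith [hμ.1]
  have hμ₂ : μ < 0 := by linarith [hμ.2]
  obtain ⟨hu1, hu2, -, -⟩ := klwjA_orderZero hμ θ
  have hF : rayDispersion (θ, bandFermiRadius μ θ) = μ := rayDispersion_bandFermiRadius hμ₁ hμ₂ θ
  have hπ := Real.pi_lt_d6
  refine checkCert_sound prmA prmA_S_pos mem_pi_piA jetProg jetIx tabA (-87/80) (-9/80) certA certA_ok ?_ ?_ ?_ ?_ ?_ ?_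
  · simpa using hθ.1
  · have : θ ≤ π / 4 := hθ.2
    have h2 : (((3927/5000 : ℚ)) : ℝ) = 0.7854 := by norm_num
    rw [h2]; linarith
  · have h2 : (((1829/1000 : ℚ)) : ℝ) = 1.829 := by norm_num
    rw [h2]; exact hu1
  · have h2 : (((2807/1000 : ℚ)) : ℝ) = 2.807 := by norm_num
    rw [h2]; exact hu2
  · have h2 : (((-87/80 : ℚ)) : ℝ) = -1.0875 := by norm_num
    rw [h2, hF]; exact hμ.1
  · have h2 : (((-9/80 : ℚ)) : ℝ) = -0.1125 := by norm_num
    rw [h2, hF]; exact hμ.2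

/-- **The twelve derivative entries (and `G0`) of `klwjTableA`, first octant**, as bounds on iterated derivatives. -/
theorem klwjA_jets_octant {μ : ℝ} (hμ : μ ∈ Icc (-1.0875 : ℝ) (-0.1125)) {θ : ℝ} (hθ : θ ∈ Icc 0 (π / 4)) :
    (|iteratedDeriv 1 (bandFermiRadius μ) θ| ≤ klwjTableA.R1 ∧ |iteratedDeriv 2 (bandFermiRadius μ) θ| ≤ klwjTableA.R2 ∧
      |iteratedDeriv 3 (bandFermiRadius μ) θ| ≤ klwjTableA.R3 ∧ |iteratedDeriv 4 (bandFermiRadius μ) θ| ≤ klwjTableA.R4) ∧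
    (|iteratedDeriv 1 (fun ϑ => rayDispersionDt ϑ (bandFermiRadius μ ϑ)) θ| ≤ klwjTableA.D1 ∧
      |iteratedDeriv 2 (fun ϑ => rayDispersionDt ϑ (bandFermiRadius μ ϑ)) θ| ≤ klwjTableA.D2 ∧
      |iteratedDeriv 3 (fun ϑ => rayDispersionDt ϑ (bandFermiRadius μ ϑ)) θ| ≤ klwjTableA.D3 ∧
      |iteratedDeriv 4 (fun ϑ => rayDispersionDt ϑ (bandFermiRadius μ ϑ)) θ| ≤ klwjTableA.D4) ∧
    (|iteratedDeriv 0 (fun ϑ => bandFermiRadius μ ϑ / rayDispersionDt ϑ (bandFermiRadius μ ϑ)) θ| ≤ klwjTableA.G0 ∧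
      |iteratedDeriv 1 (fun ϑ => bandFermiRadius μ ϑ / rayDispersionDt ϑ (bandFermiRadius μ ϑ)) θ| ≤ klwjTableA.G1 ∧
      |iteratedDeriv 2 (fun ϑ => bandFermiRadius μ ϑ / rayDispersionDt ϑ (bandFermiRadius μ ϑ)) θ| ≤ klwjTableA.G2 ∧
      |iteratedDeriv 3 (fun ϑ => bandFermiRadius μ ϑ / rayDispersionDt ϑ (bandFermiRadius μ ϑ)) θ| ≤ klwjTableA.G3 ∧
      |iteratedDeriv 4 (fun ϑ => bandFermiRadius μ ϑ / rayDispersionDt ϑ (bandFermiRadius μ ϑ)) θ| ≤ klwjTableA.G4) := by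
  have hμ₁ : -4 < μ := by linarith [hμ.1]
  have hμ₂ : μ < 0 := by linarith [hμ.2]
  have hrows := jetRows_octant hμ hθ
  simp only [JetRows] at hrows
  obtain ⟨h1, h2, h3, h4, h5, h6, h7, h8, h9, h10, h11, h12, h13⟩ := hrows
  -- the program's outputs are the jet terms of part 1 (part 3a), whose values are the iterated derivatives (part 1b)
  rw [treeAlg_out_R1] at h1; rw [treeAlg_out_R2] at h2; rw [treeAlg_out_R3] at h3; rw [treeAlg_out_R4] at h4
  rw [treeAlg_out_D1] at h5; rw [treeAlg_out_D2] at h6; rw [treeAlg_out_D3] at h7; rw [treeAlg_out_D4] at h8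
  rw [treeAlg_out_G0] at h9; rw [treeAlg_out_G1] at h10; rw [treeAlg_out_G2] at h11; rw [treeAlg_out_G3] at h12
  rw [treeAlg_out_G4] at h13
  have eB : JE.atomsAt θ (bandFermiRadius μ θ) = JE.Bc μ θ := rfl
  rw [eB] at h1 h2 h3 h4 h5 h6 h7 h8 h9 h10 h11 h12 h13
  rw [← JE.iteratedDeriv_bandFermiRadius hμ₁ hμ₂] at h1 h2 h3 h4
  rw [← JE.iteratedDeriv_radialSlope hμ₁ hμ₂] at h5 h6 h7 h8
  rw [show JE.divW (JE.atom 2) 1 = JE.Dc^[0] (JE.divW (JE.atom 2) 1) from rfl] at h9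
  rw [← JE.iteratedDeriv_polarJac hμ₁ hμ₂] at h9 h10 h11 h12 h13
  -- the rational table entries are the real ones
  have c1 : ((tabA.R1 : ℚ) : ℝ) = klwjTableA.R1 := by norm_num [tabA, klwjTableA]
  have c2 : ((tabA.R2 : ℚ) : ℝ) = klwjTableA.R2 := by norm_num [tabA, klwjTableA]
  have c3 : ((tabA.R3 : ℚ) : ℝ) = klwjTableA.R3 := by norm_num [tabA, klwjTableA]
  have c4 : ((tabA.R4 : ℚ) : ℝ) = klwjTableA.R4 := by norm_num [tabA, klwjTableA]
  have c5 : ((tabA.D1 : ℚ) : ℝ) = klwjTableA.D1 := by norm_num [tabA, klwjTableA]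
  have c6 : ((tabA.D2 : ℚ) : ℝ) = klwjTableA.D2 := by norm_num [tabA, klwjTableA]
  have c7 : ((tabA.D3 : ℚ) : ℝ) = klwjTableA.D3 := by norm_num [tabA, klwjTableA]
  have c8 : ((tabA.D4 : ℚ) : ℝ) = klwjTableA.D4 := by norm_num [tabA, klwjTableA]
  have c9 : ((tabA.G0 : ℚ) : ℝ) = klwjTableA.G0 := by norm_num [tabA, klwjTableA]
  have c10 : ((tabA.G1 : ℚ) : ℝ) = klwjTableA.G1 := by norm_num [tabA, klwjTableA]
  have c11 : ((tabA.G2 : ℚ) : ℝ) = klwjTableA.G2 := by norm_num [tabA, klwjTableA]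
  have c12 : ((tabA.G3 : ℚ) : ℝ) = klwjTableA.G3 := by norm_num [tabA, klwjTableA]
  have c13 : ((tabA.G4 : ℚ) : ℝ) = klwjTableA.G4 := by norm_num [tabA, klwjTableA]
  rw [c1] at h1; rw [c2] at h2; rw [c3] at h3; rw [c4] at h4; rw [c5] at h5; rw [c6] at h6; rw [c7] at h7; rw [c8] at h8
  rw [c9] at h9; rw [c10] at h10; rw [c11] at h11; rw [c12] at h12; rw [c13] at h13
  exact ⟨⟨h1, h2, h3, h4⟩, ⟨h5, h6, h7, h8⟩, ⟨h9, h10, h11, h12, h13⟩⟩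

/-! ## §2 Every angle; `KlwjCertA` -/

/-- **The derivative entries of `klwjTableA` at EVERY angle** (`D₄` reduction, part 1c). -/
theorem klwjA_jets {μ : ℝ} (hμ : μ ∈ Icc (-1.0875 : ℝ) (-0.1125)) (θ : ℝ) :
    (|iteratedDeriv 1 (bandFermiRadius μ) θ| ≤ klwjTableA.R1 ∧ |iteratedDeriv 2 (bandFermiRadius μ) θ| ≤ klwjTableA.R2 ∧
      |iteratedDeriv 3 (bandFermiRadius μ) θ| ≤ klwjTableA.R3 ∧ |iteratedDeriv 4 (bandFermiRadius μ) θ| ≤ klwjTableA.R4) ∧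
    (|iteratedDeriv 1 (fun ϑ => rayDispersionDt ϑ (bandFermiRadius μ ϑ)) θ| ≤ klwjTableA.D1 ∧
      |iteratedDeriv 2 (fun ϑ => rayDispersionDt ϑ (bandFermiRadius μ ϑ)) θ| ≤ klwjTableA.D2 ∧
      |iteratedDeriv 3 (fun ϑ => rayDispersionDt ϑ (bandFermiRadius μ ϑ)) θ| ≤ klwjTableA.D3 ∧
      |iteratedDeriv 4 (fun ϑ => rayDispersionDt ϑ (bandFermiRadius μ ϑ)) θ| ≤ klwjTableA.D4) ∧
    (|iteratedDeriv 1 (fun ϑ => bandFermiRadius μ ϑ / rayDispersionDt ϑ (bandFermiRadius μ ϑ)) θ| ≤ klwjTableA.G1 ∧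
      |iteratedDeriv 2 (fun ϑ => bandFermiRadius μ ϑ / rayDispersionDt ϑ (bandFermiRadius μ ϑ)) θ| ≤ klwjTableA.G2 ∧
      |iteratedDeriv 3 (fun ϑ => bandFermiRadius μ ϑ / rayDispersionDt ϑ (bandFermiRadius μ ϑ)) θ| ≤ klwjTableA.G3 ∧
      |iteratedDeriv 4 (fun ϑ => bandFermiRadius μ ϑ / rayDispersionDt ϑ (bandFermiRadius μ ϑ)) θ| ≤ klwjTableA.G4) := by
  have hμ₁ : -4 < μ := by linarith [hμ.1]
  have hμ₂ : μ < 0 := by linarith [hμ.2]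
  obtain ⟨θ₀, hθ₀, hjets⟩ := exists_octant_absJets hμ₁ hμ₂ θ
  obtain ⟨hR, hD, hG⟩ := klwjA_jets_octant hμ hθ₀
  refine ⟨⟨?_, ?_, ?_, ?_⟩, ⟨?_, ?_, ?_, ?_⟩, ⟨?_, ?_, ?_, ?_⟩⟩
  · rw [(hjets 1).1]; exact hR.1
  · rw [(hjets 2).1]; exact hR.2.1
  · rw [(hjets 3).1]; exact hR.2.2.1
  · rw [(hjets 4).1]; exact hR.2.2.2
  · rw [(hjets 1).2.1]; exact hD.1
  · rw [(hjets 2).2.1]; exact hD.2.1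
  · rw [(hjets 3).2.1]; exact hD.2.2.1
  · rw [(hjets 4).2.1]; exact hD.2.2.2
  · rw [(hjets 1).2.2]; exact hG.2.1
  · rw [(hjets 2).2.2]; exact hG.2.2.1
  · rw [(hjets 3).2.2]; exact hG.2.2.2.1
  · rw [(hjets 4).2.2]; exact hG.2.2.2.2

/-- Iterated derivatives of orders `1 … 4` as nested `deriv`s (the table's convention). -/
theorem iteratedDeriv_le_four (f : ℝ → ℝ) :
    iteratedDeriv 1 f = deriv f ∧ iteratedDeriv 2 f = deriv (deriv f) ∧ iteratedDeriv 3 f = deriv (deriv (deriv f)) ∧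
      iteratedDeriv 4 f = deriv (deriv (deriv (deriv f))) := by
  refine ⟨iteratedDeriv_one, ?_, ?_, ?_⟩ <;> rw [iteratedDeriv_eq_iterate] <;> rfl

/-- **`KlwjCertA` IS A THEOREM**: the polar-jet table `klwjTableA` bounds the free band's polar Fermi radius, its radial slope, its
polar Jacobian and their first four angular derivatives, for every `μ ∈ [-1.0875, -0.1125]` and every angle — the (C) closer's
producer hypothesis `hcertA` discharged in the kernel (interval arithmetic of `Literature/Analysis/ValidatedNumerics`, 825-leaf box
certificate; order zero by p1b's `klwjA_orderZero`).  [cite: BenfattoGiulianiMastropietro2006, §2.4 Lemma 2.1 (2.40)] -/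
theorem klwjCertA_holds : KlwjCertA := by
  refine klwjCertA_of_jets fun μ hμ θ => ?_
  obtain ⟨hR, hD, hG⟩ := klwjA_jets hμ θ
  obtain ⟨e1, e2, e3, e4⟩ := iteratedDeriv_le_four (bandFermiRadius μ)
  obtain ⟨f1, f2, f3, f4⟩ := iteratedDeriv_le_four (freeRadialSlope μ)
  obtain ⟨g1, g2, g3, g4⟩ := iteratedDeriv_le_four (freePolarJac μ)
  have hDdef : freeRadialSlope μ = fun ϑ => rayDispersionDt ϑ (bandFermiRadius μ ϑ) := rfl
  have hGdef : freePolarJac μ = fun ϑ => bandFermiRadius μ ϑ / rayDispersionDt ϑ (bandFermiRadius μ ϑ) := rfl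
  rw [← e4, ← e3, ← e2, ← e1, ← f4, ← f3, ← f2, ← f1, ← g4, ← g3, ← g2, ← g1, hDdef, hGdef]
  exact ⟨hR, hD, hG⟩

end Summit.HubbardSuperconductivity.HubbardSuperconductivity.Theorems.FreeBandJets

end
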